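import Literature.NumberTheory.LFunctions.WeilTwoPrimeOddMarginIDef
import HarnessLib

/-!
# Two-prime odd-margin certificate I: `0 ≤ κ' ≤ κ`, the margin `κ − κ' ≥ 1/2000000000`, and the scalar side conditions

`κ' ≤ weilCert23I.kappaQ`, `1/2000000000 ≤ kappaQ − κ'` and `checkScalars`, each by one kernel evaluation (no literal for `κ` is asserted). Pure proof file.
-/

noncomputable section

namespace Literature.NumberTheory.LFunctions

set_option maxHeartbeats 0 in
/-- `0 ≤ κ' ≤ κ` for certificate I (`κ` = `weilCert23I.kappaQ`, evaluated by the kernel: it involves the `|γ|`-moment `ν'_abs` and `max_j bnd_j` over the 248 cells). [folklore] -/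
theorem kappa'_nonneg_le_weilCert23I : 0 ≤ weilCert23IKappa' ∧ weilCert23IKappa' ≤ weilCert23I.kappaQ := by
  refine ⟨by unfold weilCert23IKappa'; norm_num, ?_⟩
  have h : decide (weilCert23IKappa' ≤ weilCert23I.kappaQ) = true := by decide +kernel
  exact of_decide_eq_true h

set_option maxHeartbeats 0 in
/-- The margin `κ − κ'` of certificate I is at least `1/2000000000`. [folklore] -/
theorem margin_weilCert23I : (1/2000000000 : ℚ) ≤ weilCert23I.kappaQ - weilCert23IKappa' := by
  have h : decide ((1/2000000000 : ℚ) ≤ weilCert23I.kappaQ - weilCert23IKappa') = true := by decide +kernel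
  exact of_decide_eq_true h

set_option maxHeartbeats 0 in
/-- **Kernel check of the scalar side conditions** of certificate I (`0 < b ≤ a₀ ≤ 1`, `2a₀T ≤ N+2`, Taylor remainder, `N+1 = 2nb`, `κ ≥ 0`). [folklore] -/
theorem checkScalars_weilCert23I : weilCert23I.checkScalars = true := by
  decide +kernel

end Literature.NumberTheory.LFunctions
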